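import Literature.AlgebraicGeometry.AbelianSchemes.DualAbelianSchemeExistsLetter
import Literature.AlgebraicGeometry.AbelianSchemes.DualPairHatRelDim
import HarnessLib

/-!
# P-2′ «DUAL-S» is bare existence: `dualAbelianSchemeExists ↔ ∀ S A, Nonempty A.DualPair` (the relative-dimension clause is a theorem)

Layer `Literature/AlgebraicGeometry/AbelianSchemes`, namespace `Literature.AlgebraicGeometry.AbelianSchemes`.
THEOREMS ONLY (no definition, no named fact, no instance, no notation, no `sorry`).  Cell `hodgecm-mathlib` (D-0151), P6 «MOD programme»
(prover seat B-p02 (g22); books note of LEAD F0P6-plan (g3) 23:22:32Z «P-2′ shrinks to bare existence (i)»).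

The printed row P-2′ ★ `dualAbelianSchemeExists` ([GortzWedhorn2023] Cor. 27.212 + Rem. 27.218 (1)) is typed as
`∀ S A, ∃ D : A.DualPair, ∀ g, A.IsOfRelDim g → D.hat.IsOfRelDim g`.  Since ★ (s2-rd) `DualPair.hat_isOfRelDim` (B-p08 (g33), p847238) proves
clause (ii) «`dim(Xᵗ∕S) = dim(X∕S)`» for EVERY dual pair over ANY base, the named fact is EQUIVALENT to bare existence (i):

* **`dualAbelianSchemeExists_iff_forall_nonempty_dualPair`** — `dualAbelianSchemeExists ↔ ∀ (S : Scheme.{0}) (A : AbelianSchemeOver S), Nonempty A.DualPair`;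
* **`dualAbelianSchemeExists_of_forall_nonempty_dualPair`** — the direction the in-house DUAL-S existence road (D2 bricks → Poincaré sheaf descent →
  `Nonempty A.DualPair`) will use to DISCHARGE the letter;
* `exists_dualPair_hat_isOfRelDim_of_nonempty` — per abelian scheme: `Nonempty A.DualPair → A.IsOfRelDim g → ∃ D, D.hat.IsOfRelDim g`.

HC_CM is proved only modulo the printed citations (2 remaining named inputs hLiu418, h413) until rung 0 closes; this file asserts nothing about HC,
discharges no named fact, and is count-neutral ★ capital.

## References
* [GortzWedhorn2023] U. Görtz, T. Wedhorn, *Algebraic Geometry II* (2023), Cor. 27.212 (pp. 685–686), Thm. 27.198 (2) (pp. 679–680), Remark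
  27.218 (1) (p. 689).
* [MumfordAV1970] D. Mumford, *Abelian Varieties* (1970), §13 Cor. 3 (p. 130) and pp. 123–131.
-/

set_option autoImplicit false

noncomputable section

universe u

open CategoryTheory AlgebraicGeometry

namespace Literature.AlgebraicGeometry.AbelianSchemes

/-- Per abelian scheme: a dual pair, if one exists, can be taken with dual of relative dimension `g` — indeed ANY dual pair qualifies
(★ `DualPair.hat_isOfRelDim`, [MumfordAV1970] §13 Cor. 3 in families). [cite: GortzWedhorn2023, Thm. 27.198 (2) (pp. 679–680)]
[cite: MumfordAV1970, §13 Cor. 3 (p. 130)] -/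
theorem exists_dualPair_hat_isOfRelDim_of_nonempty {S : Scheme.{u}} {A : AbelianSchemeOver S} (h : Nonempty A.DualPair) {g : ℕ}
    (hA : A.IsOfRelDim g) : ∃ D : A.DualPair, D.hat.IsOfRelDim g := by
  obtain ⟨D⟩ := h
  exact ⟨D, D.hat_isOfRelDim hA⟩

/-- **Bare existence of dual pairs implies the printed row P-2′** `dualAbelianSchemeExists` (its relative-dimension clause being ★
`DualPair.hat_isOfRelDim`) — the form in which an in-house construction of the dual abelian scheme discharges the letter.
[cite: GortzWedhorn2023, Cor. 27.212 (pp. 685–686); Remark 27.218 (1) (p. 689)] -/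
theorem dualAbelianSchemeExists_of_forall_nonempty_dualPair
    (h : ∀ (S : Scheme.{0}) (A : AbelianSchemeOver S), Nonempty A.DualPair) : dualAbelianSchemeExists :=
  fun S A => by
    obtain ⟨D⟩ := h S A
    exact ⟨D, fun _ hA => D.hat_isOfRelDim hA⟩

/-- **P-2′ «DUAL-S» IS BARE EXISTENCE**: `dualAbelianSchemeExists ↔` every abelian scheme over every base (universe `0`) has a dual pair
([MilneAV2008] I §8 interface ★ `DualPair`); clause (ii) «`dim(Xᵗ∕S) = dim(X∕S)`» of [GortzWedhorn2023] Rem. 27.218 (1) is the theorem ★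
`DualPair.hat_isOfRelDim`. [cite: GortzWedhorn2023, Cor. 27.212 (pp. 685–686); Remark 27.218 (1) (p. 689)] [cite: MumfordAV1970, §13 Cor. 3 (p. 130)] -/
theorem dualAbelianSchemeExists_iff_forall_nonempty_dualPair :
    dualAbelianSchemeExists ↔ ∀ (S : Scheme.{0}) (A : AbelianSchemeOver S), Nonempty A.DualPair :=
  ⟨fun h _ A => nonempty_dualPair h A, dualAbelianSchemeExists_of_forall_nonempty_dualPair⟩

end Literature.AlgebraicGeometry.AbelianSchemes

end
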